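import Literature.AlgebraicTopology.Homotopy.CubeLifting
import Literature.AlgebraicTopology.Homotopy.CWHomotopyLifting
import HarnessLib

/-!
# A weak homotopy equivalence lifts all balls; homotopy invariance and two-out-of-three

Topic `Literature/AlgebraicTopology/Homotopy`. Step 5/6 of the proof of the named fact
`Literature.AlgebraicTopology.Homotopy.whitehead_exists_homotopyEquiv_of_isWeakHomotopyEquiv` (Hatcher, *Algebraic Topology*
(2002), Thm. 4.5; Miller 2020, Thm. 46.9), all PROVED:

* `Literature.AlgebraicTopology.Homotopy.IsWeakHomotopyEquiv.ballLift`: a weak homotopy equivalence `f` lifts `n`-balls rel boundary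
  up to homotopy for every `n` (`CWLift.BallLift f n`, the hypothesis of
  `CWLift.exists_lift_homotopic`). The hypotheses (inj)/(surj) of `CubeLift.liftsRel_cube` are
  derived from bijectivity of `f_*` on `πₙ` for all `n` and of `π₀` (for the index type
  `{j : Fin (n+1) // j ≠ i}` by transport of generalized loops along an equivalence of index
  types, `GenLoop.congr`, and for the empty index type from `π₀`), and the cube `(Iⁿ, ∂Iⁿ)` is
  transported to the ball `(Dⁿ, ∂Dⁿ)` of `ℝⁿ` (sup norm) along `CubeHEP.cubeToBall`.
* **homotopy invariance**: if `φ ≃ ψ` and `ψ_*` is injective (resp. surjective) on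
  `π_N(X, x) → π_N(Y, ψ x)` then so is `φ_*` on `π_N(X, x) → π_N(Y, φ x)`
  (`injective_homotopyGroupMap_of_homotopic`, `surjective_homotopyGroupMap_of_homotopic`;
  Hatcher 2002, §4.1, p. 341 and Ex. 4.1.2: the change-of-basepoint isomorphism `β_γ` along
  the track `γ` of the homotopy — here via `CubeHEP.homotopicRel_of_homotopies`), whence
  `isWeakHomotopyEquiv_of_homotopic`.
* `Literature.AlgebraicTopology.Homotopy.IsWeakHomotopyEquiv.of_comp_homotopic_id` (**two out of three**, the case used in
  Whitehead's theorem): if `f` is a weak homotopy equivalence and `f ∘ g ≃ 𝟙` then `g` is a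
  weak homotopy equivalence. (That homotopy equivalences are weak homotopy equivalences is
  `isWeakHomotopyEquiv_homotopyEquiv` of `HomotopyEquivWeakEquivProofs.lean`, not repeated here.)
* `Literature.AlgebraicTopology.Homotopy.isWeakHomotopyEquiv_of_liftsRel` (the converse direction, for later use in the relative
  Hurewicz programme): a map (from a nonempty space) lifting all cubes rel boundary is a weak
  homotopy equivalence.

## References

* A. Hatcher, *Algebraic Topology*, CUP (2002), §4.1 pp. 341–342, 346, 352; Lemma 4.6,
  Prop. 4.22. [HatcherAT2002]
-/

noncomputable section

open Set Metric unitInterval Function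
open scoped Topology Topology.Homotopy unitInterval

namespace Literature.AlgebraicTopology.Homotopy

open GenLoopPath CubeLift

variable {X Y Z : Type*} [TopologicalSpace X] [TopologicalSpace Y] [TopologicalSpace Z]

/-! ### Transport of generalized loops along an equivalence of index types -/

section IndexTransport

variable {N N' : Type*} {x : X}

/-- `GenLoop.congr` (precomposition with `t ↦ t ∘ e`) preserves homotopy rel boundary. Private
local helper: the public statement is `genLoop_homotopic_congr` / `homotopyGroupCongr` of
`HomologyWeakEquivalence.lean` (same topic, landed in parallel; not imported here to keep the
Whitehead chain free of the singular-homology files that file imports). [folklore] -/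
private theorem congrCube_homotopic (e : N ≃ N') {p q : Ω^ N X x} (h : GenLoop.Homotopic p q) :
    GenLoop.Homotopic (GenLoop.congr x e p) (GenLoop.congr x e q) := by
  refine homotopicRel_precomp h (⟨fun (t : N' → I) (m : N) => t (e m), by fun_prop⟩ :
    C(N' → I, N → I)) ?_
  rintro t ⟨n, hn⟩
  exact ⟨e.symm n, by simpa using hn⟩

/-- `GenLoop.congr` reflects and preserves homotopy rel boundary (private helper, see
`genLoop_homotopic_congr`). [folklore] -/
private theorem congrCube_homotopic_iff (e : N ≃ N') {p q : Ω^ N X x} :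
    GenLoop.Homotopic (GenLoop.congr x e p) (GenLoop.congr x e q) ↔ GenLoop.Homotopic p q := by
  refine ⟨fun h => ?_, congrCube_homotopic e⟩
  have h' := congrCube_homotopic e.symm h
  have hp : GenLoop.congr x e.symm (GenLoop.congr x e p) = p := (GenLoop.congr x e).symm_apply_apply p
  have hq : GenLoop.congr x e.symm (GenLoop.congr x e q) = q := (GenLoop.congr x e).symm_apply_apply q
  rwa [hp, hq] at h'

/-- `GenLoop.congr` commutes with `f ∘ -` (private helper; public form
`homotopyGroupCongr_homotopyGroupMap` in `HomologyWeakEquivalence.lean`). [folklore] -/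
private theorem congrCube_genLoopMap (e : N ≃ N') (f : C(X, Y)) (p : Ω^ N X x) :
    GenLoop.congr (f x) e (genLoopMap f x p) = genLoopMap f x (GenLoop.congr x e p) := rfl

/-- Injectivity of `f ∘ -` on homotopy classes of generalized loops transports along an
equivalence of index types. [folklore] -/
theorem genLoopMap_injective_of_equiv (e : N ≃ N') (f : C(X, Y))
    (h : ∀ p q : Ω^ N X x, GenLoop.Homotopic (genLoopMap f x p) (genLoopMap f x q) →
      GenLoop.Homotopic p q)
    (p q : Ω^ N' X x) (hpq : GenLoop.Homotopic (genLoopMap f x p) (genLoopMap f x q)) :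
    GenLoop.Homotopic p q := by
  rw [← congrCube_homotopic_iff e.symm] at hpq ⊢
  exact h _ _ hpq

end IndexTransport

/-! ### From a weak homotopy equivalence to (inj) and (surj) -/

section InjSurj

variable {f : C(X, Y)}

/-- For a weak homotopy equivalence, `f ∘ -` is injective on homotopy classes rel boundary of
`(n+1)`-dimensional generalized loops (injectivity of `f_*` on `π_{n+1}`, unpacked).
[folklore] -/
theorem IsWeakHomotopyEquiv.genLoopMap_injective_fin (hf : IsWeakHomotopyEquiv f) (n : ℕ) (x : X)
    (p q : Ω^ (Fin (n + 1)) X x)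
    (hpq : GenLoop.Homotopic (genLoopMap f x p) (genLoopMap f x q)) : GenLoop.Homotopic p q := by
  have h : homotopyGroupMap f x (⟦p⟧ : π_ (n + 1) X x) = homotopyGroupMap f x (⟦q⟧ : π_ (n + 1) X x) := by
    rw [homotopyGroupMap_mk, homotopyGroupMap_mk]
    exact Quotient.sound hpq
  exact Quotient.exact ((hf.2 n x).1 h)

/-- For a weak homotopy equivalence, `f ∘ -` is injective on homotopy classes of
`0`-dimensional generalized loops, i.e. on path components (injectivity of `f_*` on `π₀`,
unpacked). [folklore] -/
theorem IsWeakHomotopyEquiv.genLoopMap_injective_of_isEmpty {N : Type*} [IsEmpty N]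
    (hf : IsWeakHomotopyEquiv f) (x : X) (p q : Ω^ N X x)
    (hpq : GenLoop.Homotopic (genLoopMap f x p) (genLoopMap f x q)) : GenLoop.Homotopic p q := by
  rw [genLoop_homotopic_iff_joined] at hpq ⊢
  -- evaluate at the unique point of the cube
  let t₀ : N → I := isEmptyElim
  obtain ⟨γ⟩ := hpq
  have hj : Joined (f (p t₀)) (f (q t₀)) :=
    ⟨(γ.map (continuous_eval_const t₀ : Continuous fun r : Ω^ N Y (f x) => r t₀)).cast rfl rfl⟩
  have hπ : zerothHomotopyMap f (ZerothHomotopy.mk (p t₀)) = zerothHomotopyMap f (ZerothHomotopy.mk (q t₀)) := by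
    rw [zerothHomotopyMap_mk, zerothHomotopyMap_mk]
    exact Quotient.sound hj
  obtain ⟨δ⟩ : Joined (p t₀) (q t₀) := Quotient.exact (hf.1.1 hπ)
  -- back to generalized loops: `y ↦ const y`
  have hc : Continuous fun y : X => ((genLoopHomeoOfIsEmpty N x).symm y : Ω^ N X x) :=
    (genLoopHomeoOfIsEmpty N x).symm.continuous
  have hp : (genLoopHomeoOfIsEmpty N x).symm (p t₀) = p := by
    have : p t₀ = genLoopHomeoOfIsEmpty N x p := congr_arg p (Subsingleton.elim _ _)
    rw [this, Homeomorph.symm_apply_apply]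
  have hq : (genLoopHomeoOfIsEmpty N x).symm (q t₀) = q := by
    have : q t₀ = genLoopHomeoOfIsEmpty N x q := congr_arg q (Subsingleton.elim _ _)
    rw [this, Homeomorph.symm_apply_apply]
  exact ⟨(δ.map hc).cast hp.symm hq.symm⟩

/-- (inj) for the index type `{j : Fin (n+1) // j ≠ i}` (empty for `n = 0`, of size `n`
otherwise). [folklore] -/
theorem IsWeakHomotopyEquiv.genLoopMap_injective_sub (hf : IsWeakHomotopyEquiv f) (n : ℕ)
    (i : Fin (n + 1)) (x : X) (p q : Ω^ {j // j ≠ i} X x)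
    (hpq : GenLoop.Homotopic (genLoopMap f x p) (genLoopMap f x q)) : GenLoop.Homotopic p q := by
  cases n with
  | zero =>
    haveI : IsEmpty {j : Fin 1 // j ≠ i} := ⟨fun j => j.2 (Subsingleton.elim _ _)⟩
    exact hf.genLoopMap_injective_of_isEmpty x p q hpq
  | succ n =>
    -- `{j : Fin (n+2) // j ≠ i} ≃ Fin (n+1)`
    have hcard : Fintype.card {j : Fin (n + 2) // j ≠ i} = n + 1 := by
      rw [Fintype.card_subtype_compl, Fintype.card_fin, Fintype.card_subtype_eq]
      omega
    let e : Fin (n + 1) ≃ {j : Fin (n + 2) // j ≠ i} :=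
      (Fintype.equivFinOfCardEq hcard).symm
    exact genLoopMap_injective_of_equiv e f (hf.genLoopMap_injective_fin (n := n) x) p q hpq

/-- (surj) in cylinder form for the index type `{j : Fin (n+1) // j ≠ i}`: every map of the
cylinder `I × I^{Fin (n+1) ∖ i}` constant `= f x` on its boundary is homotopic rel boundary to
`f ∘ e` with `e` constant `= x` on the boundary (surjectivity of `f_*` on `π_{n+1}`, transported
along `Cube.insertAt i`). [folklore] -/
theorem IsWeakHomotopyEquiv.exists_lift_cylinder (hf : IsWeakHomotopyEquiv f) (n : ℕ)
    (i : Fin (n + 1)) (x : X) (d : C(I × ({j // j ≠ i} → I), Y))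
    (hd : ∀ p ∈ cylBd {j // j ≠ i}, d p = f x) :
    ∃ e : C(I × ({j // j ≠ i} → I), X), (∀ p ∈ cylBd {j // j ≠ i}, e p = x) ∧
      (f.comp e).HomotopicRel d (cylBd {j // j ≠ i}) := by
  -- `d` on the cube
  have hsplit : ∀ z ∈ Cube.boundary (Fin (n + 1)), Cube.splitAt i z ∈ cylBd {j // j ≠ i} := by
    intro z hz
    have h := insertAt_mem_boundary_iff i (Cube.splitAt i z)
    rw [show Cube.insertAt i (Cube.splitAt i z) = z from (Cube.splitAt i).symm_apply_apply z] at h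
    exact h.1 hz
  let d' : Ω^ (Fin (n + 1)) Y (f x) :=
    ⟨d.comp (Cube.splitAt i : C(Fin (n + 1) → I, I × ({j // j ≠ i} → I))),
      fun z hz => hd _ (hsplit z hz)⟩
  obtain ⟨a, ha⟩ := (hf.2 n x).2 ⟦d'⟧
  induction a using Quotient.inductionOn with
  | h e' =>
    have he' : GenLoop.Homotopic (genLoopMap f x e') d' := Quotient.exact ha
    have hins : MapsTo (Cube.insertAt i : I × ({j // j ≠ i} → I) → (Fin (n + 1) → I))
        (cylBd {j // j ≠ i}) (Cube.boundary (Fin (n + 1))) :=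
      fun p hp => (insertAt_mem_boundary_iff i p).2 hp
    refine ⟨(e' : C(Fin (n + 1) → I, X)).comp
      (Cube.insertAt i : C(I × ({j // j ≠ i} → I), Fin (n + 1) → I)), fun p hp => ?_, ?_⟩
    · exact GenLoop.boundary e' _ (hins hp)
    · have h1 := homotopicRel_precomp he'
        (Cube.insertAt i : C(I × ({j // j ≠ i} → I), Fin (n + 1) → I)) hins
      have hdd : (d' : C(Fin (n + 1) → I, Y)).comp
          (Cube.insertAt i : C(I × ({j // j ≠ i} → I), Fin (n + 1) → I)) = d := by
        ext p
        show d (Cube.splitAt i (Cube.insertAt i p)) = d p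
        rw [(Cube.splitAt i).apply_symm_apply]
      rw [hdd] at h1
      exact h1

/-- **A weak homotopy equivalence lifts the cube `(I^{n+1}, ∂I^{n+1})` rel boundary up to
homotopy.** [cite: HatcherAT2002, §4.1 Lemma 4.6 and p. 346] -/
theorem IsWeakHomotopyEquiv.liftsRel_cube_succ (hf : IsWeakHomotopyEquiv f) (n : ℕ) :
    LiftsRel f (Fin (n + 1) → I) (Cube.boundary (Fin (n + 1))) :=
  liftsRel_cube f (0 : Fin (n + 1)) (hf.genLoopMap_injective_sub n 0)
    (hf.exists_lift_cylinder n 0)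

/-- **A weak homotopy equivalence lifts the point `(I⁰, ∅)`**: every point of `Y` is joined to
a point of `f(X)` (surjectivity of `f_*` on `π₀`). [folklore] -/
theorem IsWeakHomotopyEquiv.liftsRel_cube_zero (hf : IsWeakHomotopyEquiv f) :
    LiftsRel f (Fin 0 → I) (Cube.boundary (Fin 0)) := by
  intro ξ c _ _
  let z₀ : Fin 0 → I := fun i => i.elim0
  obtain ⟨a, ha⟩ := hf.1.2 (ZerothHomotopy.mk (c z₀))
  induction a using ZerothHomotopy.rec with
  | mk x =>
    rw [zerothHomotopyMap_mk] at ha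
    obtain ⟨γ⟩ : Joined (f x) (c z₀) := Quotient.exact ha
    have hb : Cube.boundary (Fin 0) = ∅ := by
      ext z; simp only [Cube.boundary, mem_setOf_eq, mem_empty_iff_false, iff_false]
      rintro ⟨i, -⟩; exact i.elim0
    refine ⟨ContinuousMap.const _ x, fun p hp => ?_, ?_⟩
    · rw [hb] at hp; exact hp.elim
    · rw [hb, ContinuousMap.homotopicRel_empty]
      refine ⟨{ toFun := fun q => γ q.1
                continuous_toFun := by fun_prop
                map_zero_left := fun z => by simp
                map_one_left := fun z => ?_ }⟩
      show γ 1 = c z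
      rw [γ.target, Subsingleton.elim z z₀]

/-! ### From cubes to balls -/

/-- **Lifting the cube rel boundary gives lifting the ball rel boundary** (`CWLift.BallLift`),
by the affine identification `Iⁿ ≅ Dⁿ ⊆ ℝⁿ` (sup norm) of `CubeHEP.cubeToBall`/`ballToCube`.
[folklore] -/
theorem ballLift_of_liftsRel_cube {n : ℕ} (h : LiftsRel f (Fin n → I) (Cube.boundary (Fin n))) :
    CWLift.BallLift f n := by
  intro ξ c hξ hc hξc
  -- the data on the cube
  have hmaps : MapsTo (CubeHEP.cubeToBall : (Fin n → I) → (Fin n → ℝ)) (Cube.boundary (Fin n))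
      (sphere (0 : Fin n → ℝ) 1) := fun y hy =>
    mem_sphere_zero_iff_norm.2 ((CubeHEP.mem_boundary_iff_norm_cubeToBall y).1 hy)
  have hξ' : ContinuousOn (fun y => ξ (CubeHEP.cubeToBall y)) (Cube.boundary (Fin n)) :=
    hξ.comp CubeHEP.continuous_cubeToBall.continuousOn hmaps
  let c' : C(Fin n → I, Y) := ⟨fun y => c (CubeHEP.cubeToBall y),
    hc.comp_continuous CubeHEP.continuous_cubeToBall CubeHEP.cubeToBall_mem_closedBall⟩
  obtain ⟨Ξ', hΞ', ⟨G⟩⟩ := h (fun y => ξ (CubeHEP.cubeToBall y)) c' hξ'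
    (fun y hy => hξc _ (hmaps hy))
  -- back to the ball
  have hbdy : ∀ w ∈ sphere (0 : Fin n → ℝ) 1, CubeHEP.ballToCube w ∈ Cube.boundary (Fin n) := by
    intro w hw
    rw [CubeHEP.mem_boundary_iff_norm_cubeToBall,
      CubeHEP.cubeToBall_ballToCube (sphere_subset_closedBall hw)]
    exact mem_sphere_zero_iff_norm.1 hw
  refine ⟨fun w => Ξ' (CubeHEP.ballToCube w),
    fun q => G (σ (Set.projIcc 0 1 zero_le_one q.2), CubeHEP.ballToCube q.1),
    (Ξ'.continuous.comp CubeHEP.continuous_ballToCube).continuousOn, fun w hw => ?_,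
    (G.continuous.comp ((continuous_symm.comp (continuous_projIcc.comp continuous_snd)).prodMk
      (CubeHEP.continuous_ballToCube.comp continuous_fst))).continuousOn,
    fun w hw => ?_, fun w hw => ?_, fun w hw t ht => ?_⟩
  · show Ξ' (CubeHEP.ballToCube w) = ξ w
    rw [hΞ' _ (hbdy w hw), CubeHEP.cubeToBall_ballToCube (sphere_subset_closedBall hw)]
  · have h0 : Set.projIcc (0 : ℝ) 1 zero_le_one (0 : ℝ) = 0 := Subtype.ext (by simp)
    show G (σ (Set.projIcc 0 1 zero_le_one (0 : ℝ)), CubeHEP.ballToCube w) = c w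
    rw [h0, symm_zero, G.apply_one]
    show c (CubeHEP.cubeToBall (CubeHEP.ballToCube w)) = c w
    rw [CubeHEP.cubeToBall_ballToCube hw]
  · have h1 : Set.projIcc (0 : ℝ) 1 zero_le_one (1 : ℝ) = 1 := Subtype.ext (by simp)
    show G (σ (Set.projIcc 0 1 zero_le_one (1 : ℝ)), CubeHEP.ballToCube w) =
      f (Ξ' (CubeHEP.ballToCube w))
    rw [h1, symm_one, G.apply_zero]
    rfl
  · show G (σ (Set.projIcc 0 1 zero_le_one t), CubeHEP.ballToCube w) = c w
    rw [G.eq_fst _ (hbdy w hw)]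
    show f (Ξ' (CubeHEP.ballToCube w)) = c w
    rw [hΞ' _ (hbdy w hw), CubeHEP.cubeToBall_ballToCube (sphere_subset_closedBall hw)]
    exact (hξc w hw).symm

/-- **A weak homotopy equivalence lifts all balls rel boundary up to homotopy** (the input of
the cell-by-cell lifting `CWLift.exists_lift_homotopic`; Hatcher 2002, proof of Prop. 4.22:
"the groups `πₙ(M_f, X)` are zero, so the compression lemma applies").
[cite: HatcherAT2002, §4.1 Lemma 4.6 and Prop. 4.22] -/
theorem IsWeakHomotopyEquiv.ballLift (hf : IsWeakHomotopyEquiv f) (n : ℕ) : CWLift.BallLift f n := by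
  cases n with
  | zero => exact ballLift_of_liftsRel_cube hf.liftsRel_cube_zero
  | succ n => exact ballLift_of_liftsRel_cube (hf.liftsRel_cube_succ n)

end InjSurj

/-! ### Homotopy invariance of injectivity/surjectivity of `f_*` -/

section HomotopyInvariance

variable {N : Type*} [Fintype N] {φ ψ : C(X, Y)}

/-- If `φ ≃ ψ` and `ψ_*` is injective on `π_N(X, x)`, so is `φ_*` (Hatcher 2002, §4.1, p. 341:
change of basepoint along the track of the homotopy; here `CubeHEP.homotopicRel_of_homotopies`
with the homotopy composed with the two loops). [cite: HatcherAT2002, §4.1 p. 341] -/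
theorem injective_homotopyGroupMap_of_homotopic (H : φ.Homotopy ψ) (x : X)
    (hψ : Function.Injective (homotopyGroupMap (N := N) ψ x)) :
    Function.Injective (homotopyGroupMap (N := N) φ x) := by
  intro a b hab
  induction a using Quotient.inductionOn with
  | h p =>
    induction b using Quotient.inductionOn with
    | h q =>
      apply Quotient.sound
      have hφ : GenLoop.Homotopic (genLoopMap φ x p) (genLoopMap φ x q) := Quotient.exact hab
      obtain ⟨K⟩ := hφ
      -- `ψ p ≃ φ p ≃ φ q ≃ ψ q` with track `H(1 - s, x)`, `const`, `H(s, x)`⁻¹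
      have h : GenLoop.Homotopic (genLoopMap ψ x p) (genLoopMap ψ x q) := by
        refine CubeHEP.homotopicRel_of_homotopies (H.compContinuousMap (p : C(N → I, X)))
          K (H.compContinuousMap (q : C(N → I, X))) ?_
        intro s y hy
        show H (s, p y) = H (s, q y)
        rw [GenLoop.boundary p y hy, GenLoop.boundary q y hy]
      exact Quotient.exact (hψ (Quotient.sound h : (⟦genLoopMap ψ x p⟧ : HomotopyGroup N Y (ψ x)) = ⟦genLoopMap ψ x q⟧))

/-- If `φ ≃ ψ` and `ψ_*` is surjective onto `π_N(Y, ψ x)`, then `φ_*` is surjective onto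
`π_N(Y, φ x)` (push a loop at `φ x` along the track to `ψ x` by the HEP of `(Iᴺ, ∂Iᴺ)`, lift it
through `ψ`, and come back; the round-trip track is null). [cite: HatcherAT2002, §4.1 p. 341] -/
theorem surjective_homotopyGroupMap_of_homotopic (H : φ.Homotopy ψ) (x : X)
    (hψ : Function.Surjective (homotopyGroupMap (N := N) ψ x)) :
    Function.Surjective (homotopyGroupMap (N := N) φ x) := by
  intro b
  induction b using Quotient.inductionOn with
  | h r =>
    -- push `r` (a loop at `φ x`) along the track to a loop `r'` at `ψ x`
    obtain ⟨P, hP0, hPb⟩ := CubeHEP.exists_extension_cube (r : C(N → I, Y))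
      (fun q => H (q.1, x)) (by fun_prop) (fun y hy => by
        show H (0, x) = r y
        rw [H.apply_zero, GenLoop.boundary r y hy])
    let r' : Ω^ N Y (ψ x) := ⟨⟨fun y => P (1, y), by fun_prop⟩, fun y hy => by
      show P (1, y) = ψ x
      rw [hPb 1 y hy, H.apply_one]⟩
    obtain ⟨a, ha⟩ := hψ ⟦r'⟧
    induction a using Quotient.inductionOn with
    | h p =>
      refine ⟨⟦p⟧, ?_⟩
      rw [homotopyGroupMap_mk]
      apply Quotient.sound
      obtain ⟨K⟩ : GenLoop.Homotopic (genLoopMap ψ x p) r' := Quotient.exact ha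
      -- `φ p ≃ ψ p ≃ r' ≃ r`, tracks `H(s, x)`, `const`, `P` reversed
      let PH : (r : C(N → I, Y)).Homotopy (r' : C(N → I, Y)) :=
        { toFun := P
          continuous_toFun := P.continuous
          map_zero_left := hP0
          map_one_left := fun _ => rfl }
      refine CubeHEP.homotopicRel_of_homotopies (H.compContinuousMap (p : C(N → I, X))).symm K
        PH.symm ?_
      intro s y hy
      show H (σ s, p y) = P (σ s, y)
      rw [GenLoop.boundary p y hy, hPb (σ s) y hy]

/-- **Homotopic maps are weak homotopy equivalences together** (Hatcher 2002, §4.1, p. 341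
and p. 352). [cite: HatcherAT2002, §4.1 p. 341] -/
theorem isWeakHomotopyEquiv_of_homotopic (h : φ.Homotopic ψ) (hψ : IsWeakHomotopyEquiv ψ) :
    IsWeakHomotopyEquiv φ := by
  obtain ⟨H⟩ := h
  have hπ₀ : zerothHomotopyMap φ = zerothHomotopyMap ψ := by
    funext a
    induction a using ZerothHomotopy.rec with
    | mk x =>
      rw [zerothHomotopyMap_mk, zerothHomotopyMap_mk]
      exact ZerothHomotopy.sound ⟨⟨fun t => H (t, x), by fun_prop⟩, by simp, by simp⟩
  refine ⟨hπ₀ ▸ hψ.1, fun n x => ⟨?_, ?_⟩⟩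
  · exact injective_homotopyGroupMap_of_homotopic H x (hψ.2 n x).1
  · exact surjective_homotopyGroupMap_of_homotopic H x (hψ.2 n x).2

end HomotopyInvariance

/-! ### Two out of three -/

/-- **Two out of three for weak homotopy equivalences** (the case needed for Whitehead's
theorem): if `f` is a weak homotopy equivalence and `f ∘ g ≃ 𝟙_Y`, then `g` is a weak homotopy
equivalence (`(f ∘ g)_*` is bijective by homotopy invariance, and `f_*` is bijective).
[cite: HatcherAT2002, §4.1 p. 341 and p. 352] -/
theorem IsWeakHomotopyEquiv.of_comp_homotopic_id {f : C(X, Y)} {g : C(Y, X)}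
    (hf : IsWeakHomotopyEquiv f) (hfg : (f.comp g).Homotopic (ContinuousMap.id Y)) :
    IsWeakHomotopyEquiv g := by
  have hfgw : IsWeakHomotopyEquiv (f.comp g) := isWeakHomotopyEquiv_of_homotopic hfg IsWeakHomotopyEquiv.id
  have hπ₀ : Function.Injective (zerothHomotopyMap g) := by
    have h := hfgw.1.1
    rw [zerothHomotopyMap_comp] at h
    exact h.of_comp
  refine ⟨⟨hπ₀, fun c => ?_⟩, fun n y => ⟨fun a b hab => ?_, fun c => ?_⟩⟩
  · -- `π₀` surjective: `[g (f x)] = [x]` since `f g f x` is joined to `f x`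
    induction c using ZerothHomotopy.rec with
    | mk x =>
      refine ⟨ZerothHomotopy.mk (f x), hf.1.1 ?_⟩
      simp only [zerothHomotopyMap_mk]
      obtain ⟨H⟩ := hfg
      exact ZerothHomotopy.sound ⟨⟨fun t => H (t, f x), by fun_prop⟩, by simp, by simp⟩
  · -- `πₙ` injective
    have h := (hfgw.2 n y).1
    rw [homotopyGroupMap_comp] at h
    exact h.of_comp hab
  · -- `πₙ` surjective: `f_* c = (f ∘ g)_* a = f_* (g_* a)`
    obtain ⟨a, ha⟩ := (hfgw.2 n y).2 (homotopyGroupMap f (g y) c)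
    refine ⟨a, (hf.2 n (g y)).1 ?_⟩
    rw [homotopyGroupMap_comp] at ha
    exact ha

/-! ### Maps lifting all cubes are weak homotopy equivalences (the converse direction) -/

/-- **A map that lifts all cubes rel boundary is a weak homotopy equivalence** (the cheap
converse of `IsWeakHomotopyEquiv.liftsRel_cube_succ`/`liftsRel_cube_zero`; Hatcher 2002,
p. 346, the compression criterion (1) ⇔ (4) for `πₙ(X, A) = 0`, here for a map): surjectivity on
`π₀`/`πₙ` is lifting a point / a loop with constant boundary data, injectivity is lifting a path /
a homotopy (on the cylinder `I × Iⁿ ≅ I^{Option (Fin n)}`) whose boundary data are the two points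
/ loops. `X` must be nonempty (for `X = ∅` the hypothesis is vacuous). [cite: HatcherAT2002, §4.1 p. 346] -/
theorem isWeakHomotopyEquiv_of_liftsRel [Nonempty X] {f : C(X, Y)}
    (h : ∀ (N : Type) [Fintype N] [DecidableEq N], LiftsRel f (N → I) (Cube.boundary N)) :
    IsWeakHomotopyEquiv f := by
  classical
  refine ⟨⟨fun a b hab => ?_, fun b => ?_⟩, fun n x => ⟨fun a b hab => ?_, fun b => ?_⟩⟩
  · -- `π₀` injective: lift a path between `f x₀` and `f x₁` (cube `I¹`, boundary `{0, 1}`)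
    induction a using ZerothHomotopy.rec with
    | mk x₀ =>
      induction b using ZerothHomotopy.rec with
      | mk x₁ =>
        rw [zerothHomotopyMap_mk, zerothHomotopyMap_mk] at hab
        obtain ⟨γ⟩ : Joined (f x₀) (f x₁) := Quotient.exact hab
        let ξ : (Fin 1 → I) → X := fun t => if (t 0 : ℝ) ≤ 2⁻¹ then x₀ else x₁
        have hfin : (Cube.boundary (Fin 1)).Finite := by
          refine (Set.toFinite ({fun _ => 0, fun _ => 1} : Set (Fin 1 → I))).subset ?_
          rintro t ⟨i, hi⟩
          have ht : t = fun _ => t 0 := funext fun j => congr_arg t (Subsingleton.elim j 0)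
          rw [Subsingleton.elim i 0] at hi
          rcases hi with hi | hi
          · left; rw [ht, hi]
          · right; rw [ht, hi]; rfl
        let c : C(Fin 1 → I, Y) := ⟨fun t => γ (t 0), by fun_prop⟩
        have hagree : ∀ t ∈ Cube.boundary (Fin 1), c t = f (ξ t) := by
          rintro t ⟨i, hi⟩
          rw [Subsingleton.elim i 0] at hi
          rcases hi with hi | hi
          · show γ (t 0) = f (if (t 0 : ℝ) ≤ 2⁻¹ then x₀ else x₁)
            rw [hi]; norm_num
          · show γ (t 0) = f (if (t 0 : ℝ) ≤ 2⁻¹ then x₀ else x₁)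
            rw [hi]; norm_num
        obtain ⟨Ξ, hΞ, -⟩ := h (Fin 1) ξ c (hfin.continuousOn ξ) hagree
        apply ZerothHomotopy.sound
        have e0 : Ξ (fun _ => 0) = x₀ := by
          rw [hΞ _ ⟨0, Or.inl rfl⟩]
          show (if ((0 : I) : ℝ) ≤ 2⁻¹ then x₀ else x₁) = x₀
          norm_num
        have e1 : Ξ (fun _ => 1) = x₁ := by
          rw [hΞ _ ⟨0, Or.inr rfl⟩]
          show (if ((1 : I) : ℝ) ≤ 2⁻¹ then x₀ else x₁) = x₁
          norm_num
        exact ⟨⟨fun t => Ξ (fun _ => t), by fun_prop⟩, by simpa using e0, by simpa using e1⟩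
  · -- `π₀` surjective: lift a point (cube `I⁰`)
    induction b using ZerothHomotopy.rec with
    | mk y =>
      obtain ⟨Ξ, -, hH⟩ := h (Fin 0) (fun _ => Classical.arbitrary X) (ContinuousMap.const _ y)
        continuousOn_const (by rintro t ⟨i, -⟩; exact i.elim0)
      obtain ⟨H⟩ := hH
      let z₀ : Fin 0 → I := fun i => i.elim0
      refine ⟨ZerothHomotopy.mk (Ξ z₀), ?_⟩
      rw [zerothHomotopyMap_mk]
      exact ZerothHomotopy.sound ⟨⟨fun t => H (t, z₀), by fun_prop⟩, by simp, by simp⟩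
  · -- `π_{n+1}` injective: lift a homotopy on the cylinder
    induction a using Quotient.inductionOn with
    | h p =>
      induction b using Quotient.inductionOn with
      | h q =>
        rw [homotopyGroupMap_mk, homotopyGroupMap_mk] at hab
        obtain ⟨K⟩ : GenLoop.Homotopic (genLoopMap f x p) (genLoopMap f x q) := Quotient.exact hab
        apply Quotient.sound
        have hcyl : LiftsRel f (I × (Fin (n + 1) → I)) (cylBd (Fin (n + 1))) :=
          (h (Option (Fin (n + 1)))).of_homeomorph (cubeOptionHomeo (Fin (n + 1))).symm fun r => by
            rw [mem_boundary_iff_cubeOptionHomeo, Homeomorph.apply_symm_apply]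
        -- boundary data: `p` on the bottom half, `q` on the top half (they agree on the walls)
        let ξ : I × (Fin (n + 1) → I) → X := fun r => if (r.1 : ℝ) ≤ 2⁻¹ then p r.2 else q r.2
        have hwall : ∀ (t : I) (y : Fin (n + 1) → I), y ∈ Cube.boundary (Fin (n + 1)) → ξ (t, y) = x := by
          intro t y hy
          show (if (t : ℝ) ≤ 2⁻¹ then p y else q y) = x
          split_ifs
          · exact GenLoop.boundary p y hy
          · exact GenLoop.boundary q y hy
        have hξ : ContinuousOn ξ (cylBd (Fin (n + 1))) := by
          have hcl0 : IsClosed {r : I × (Fin (n + 1) → I) | r.1 = 0} := isClosed_eq continuous_fst continuous_const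
          have hcl1 : IsClosed {r : I × (Fin (n + 1) → I) | r.1 = 1} := isClosed_eq continuous_fst continuous_const
          have hclw : IsClosed {r : I × (Fin (n + 1) → I) | r.2 ∈ Cube.boundary (Fin (n + 1))} :=
            CubeHEP.isClosed_cubeBoundary.preimage continuous_snd
          have hset : cylBd (Fin (n + 1)) = {r : I × (Fin (n + 1) → I) | r.1 = 0} ∪ ({r | r.1 = 1} ∪
              {r | r.2 ∈ Cube.boundary (Fin (n + 1))}) := by
            ext r; simp only [mem_cylBd, mem_union, mem_setOf_eq]
          rw [hset]
          refine ContinuousOn.union_of_isClosed ?_ (ContinuousOn.union_of_isClosed ?_ ?_ hcl1 hclw)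
            hcl0 (hcl1.union hclw)
          · refine ((p : C(Fin (n + 1) → I, X)).continuous.comp continuous_snd).continuousOn.congr ?_
            rintro ⟨t, y⟩ ht
            simp only [mem_setOf_eq] at ht
            subst ht
            show (if ((0 : I) : ℝ) ≤ 2⁻¹ then p y else q y) = p y
            norm_num
          · refine ((q : C(Fin (n + 1) → I, X)).continuous.comp continuous_snd).continuousOn.congr ?_
            rintro ⟨t, y⟩ ht
            simp only [mem_setOf_eq] at ht
            subst ht
            show (if ((1 : I) : ℝ) ≤ 2⁻¹ then p y else q y) = q y
            norm_num
          · exact continuousOn_const.congr fun r hr => hwall r.1 r.2 hr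
        have hagree : ∀ r ∈ cylBd (Fin (n + 1)), (K.toContinuousMap : C(I × (Fin (n + 1) → I), Y)) r = f (ξ r) := by
          rintro ⟨t, y⟩ (ht | ht | hy)
          · dsimp only at ht; subst ht
            show K (0, y) = f (if ((0 : I) : ℝ) ≤ 2⁻¹ then p y else q y)
            rw [K.apply_zero]; norm_num
          · dsimp only at ht; subst ht
            show K (1, y) = f (if ((1 : I) : ℝ) ≤ 2⁻¹ then p y else q y)
            rw [K.apply_one]; norm_num
          · show K (t, y) = f (ξ (t, y))
            rw [hwall t y hy, K.eq_fst t hy]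
            show f (p y) = f x
            rw [GenLoop.boundary p y hy]
        obtain ⟨Ξ, hΞ, -⟩ := hcyl ξ K.toContinuousMap hξ hagree
        refine ⟨{ toFun := fun r => Ξ r
                  continuous_toFun := Ξ.continuous
                  map_zero_left := fun y => ?_
                  map_one_left := fun y => ?_
                  prop' := fun t y hy => ?_ }⟩
        · show Ξ (0, y) = p y
          rw [hΞ (0, y) (Or.inl rfl)]
          show (if ((0 : I) : ℝ) ≤ 2⁻¹ then p y else q y) = p y
          norm_num
        · show Ξ (1, y) = q y
          rw [hΞ (1, y) (Or.inr (Or.inl rfl))]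
          show (if ((1 : I) : ℝ) ≤ 2⁻¹ then p y else q y) = q y
          norm_num
        · show Ξ (t, y) = p y
          rw [hΞ (t, y) (Or.inr (Or.inr hy)), hwall t y hy]
          exact (GenLoop.boundary p y hy).symm
  · -- `π_{n+1}` surjective: lift a loop with constant boundary data
    induction b using Quotient.inductionOn with
    | h r =>
      obtain ⟨Ξ, hΞ, hH⟩ := h (Fin (n + 1)) (fun _ => x) (r : C(Fin (n + 1) → I, Y))
        continuousOn_const (fun y hy => GenLoop.boundary r y hy)
      refine ⟨⟦⟨Ξ, hΞ⟩⟧, ?_⟩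
      rw [homotopyGroupMap_mk]
      exact Quotient.sound hH

end Literature.AlgebraicTopology.Homotopy

end
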